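import Summits.QuantumFields.YangMills.Theses.PencilRigidity

/-!
# `HypercubicLimit` — structural support: extension by zero and restriction of labelled Schwinger families

Support file for crux `stmt-QuantumFields-8646` (`HypercubicLimit`), extracted from the standing disprover's work
file `Cruxes/HypercubicLimit/Disproof.lean` §4 (the one-field reduction; assembled in
`Negative/OneFieldReduction.lean`).  Tree objects only, nothing posited.

* `extendByZero c₀ S₁`: the labelled family equal to the one-field family `S₁` on the constant label string
  `c₀ ⋯ c₀` and `0` on every other string; it inherits E0 (normalisation, hermiticity), E0', E2, E3, E4,
  translation and hypercubic invariance and `HasMassGap` from `S₁`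
  (`isNormalized_extendByZero`, …, `hasMassGap_extendByZero`, `osClauses_extendByZero`; E2 by zeroing the test
  functions of label strings that are not constant `c₀`).
* `restrictTo c₀ S`: the one-field family of the species `c₀`; it inherits the same clauses
  (`osClauses_restrictTo`, `hasMassGap_restrictTo`). [folklore]
-/

noncomputable section

open scoped SchwartzMap ComplexConjugate
open MeasureTheory Filter Topology Complex
open Literature.MathematicalPhysics.AQFT Literature.MathematicalPhysics.QuantumLattice
open Literature.MathematicalPhysics.QuantumFieldTheory

namespace Summit.QuantumFields.YangMills.Theorems.HypercubicLimit.Negative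

section ExtendRestrict

variable {ι : Type}

/-! ### Label-string bookkeeping -/

/-- `all_comp_rev_iff` (auxiliary, see the module docstring). [folklore] -/
theorem all_comp_rev_iff {n : ℕ} (k : Fin n → ι) (c₀ : ι) :
    (∀ i, (k ∘ Fin.rev) i = c₀) ↔ ∀ i, k i = c₀ :=
  ⟨fun h i => by simpa using h (Fin.rev i), fun h i => h _⟩

/-- `all_append_iff` (auxiliary, see the module docstring). [folklore] -/
theorem all_append_iff {n m : ℕ} (k : Fin n → ι) (k' : Fin m → ι) (c₀ : ι) :
    (∀ i, Fin.append k k' i = c₀) ↔ (∀ i, k i = c₀) ∧ ∀ j, k' j = c₀ := by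
  refine ⟨fun h => ⟨fun i => by simpa using h (Fin.castAdd m i), fun j => by simpa using h (Fin.natAdd n j)⟩,
    fun h i => ?_⟩
  induction i using Fin.addCases with
  | left i => simpa using h.1 i
  | right j => simpa using h.2 j

/-- `all_comp_perm_iff` (auxiliary, see the module docstring). [folklore] -/
theorem all_comp_perm_iff {n : ℕ} (k : Fin n → ι) (π : Equiv.Perm (Fin n)) (c₀ : ι) :
    (∀ i, (k ∘ π) i = c₀) ↔ ∀ i, k i = c₀ :=
  ⟨fun h i => by simpa using h (π.symm i), fun h i => h _⟩

/-- `append_const` (auxiliary, see the module docstring). [folklore] -/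
theorem append_const (n m : ℕ) (c₀ : ι) :
    Fin.append (fun _ : Fin n => c₀) (fun _ : Fin m => c₀) = fun _ => c₀ := by
  funext i
  induction i using Fin.addCases with
  | left i => simp
  | right j => simp

/-! ### Extension by zero of a one-field family to a labelled family -/

/-- The labelled family which is `S₁` on the constant label string `c₀ ⋯ c₀` and `0` on every
other label string ("all other species renormalised to zero"). [folklore] -/
def extendByZero (c₀ : ι) (S₁ : SchwingerFamily (EuclideanSpace ℝ (Fin 4))) : LabelledSchwingerFamily ι (EuclideanSpace ℝ (Fin 4)) :=
  fun n k => by classical exact if (∀ i, k i = c₀) then S₁ n else 0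

variable (c₀ : ι) (S₁ : SchwingerFamily (EuclideanSpace ℝ (Fin 4)))

/-- `extendByZero_of_all` (auxiliary, see the module docstring). [folklore] -/
theorem extendByZero_of_all {n : ℕ} {k : Fin n → ι} (h : ∀ i, k i = c₀) :
    extendByZero c₀ S₁ n k = S₁ n := by
  simp [extendByZero, h]

/-- `extendByZero_of_not_all` (auxiliary, see the module docstring). [folklore] -/
theorem extendByZero_of_not_all {n : ℕ} {k : Fin n → ι} (h : ¬ ∀ i, k i = c₀) :
    extendByZero c₀ S₁ n k = 0 := by
  unfold extendByZero
  rw [if_neg h]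

/-- `extendByZero_const` (auxiliary, see the module docstring). [folklore] -/
@[simp] theorem extendByZero_const (n : ℕ) : extendByZero c₀ S₁ n (fun _ => c₀) = S₁ n :=
  extendByZero_of_all c₀ S₁ fun _ => rfl

/-- `isTimeOrdered_zero` (auxiliary, see the module docstring). [folklore] -/
theorem isTimeOrdered_zero {d : ℕ} [NeZero d] {n : ℕ} :
    IsTimeOrdered (0 : 𝓢((Fin n → EuclideanSpace ℝ (Fin d)), ℂ)) := by
  have h0 : ((0 : 𝓢((Fin n → EuclideanSpace ℝ (Fin d)), ℂ)) : (Fin n → EuclideanSpace ℝ (Fin d)) → ℂ)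
      = 0 := rfl
  rw [IsTimeOrdered, h0, tsupport_zero]
  exact Set.empty_subset _

/-- `osAdjoint_zero` (auxiliary, see the module docstring). [folklore] -/
theorem osAdjoint_zero {n : ℕ} : osAdjoint (0 : 𝓢((Fin n → (EuclideanSpace ℝ (Fin 4))), ℂ)) = 0 := by
  ext x
  rw [osAdjoint_apply]
  change conj (0 : ℂ) = 0
  exact map_zero _

variable {c₀ S₁}

/-- `isNormalized_extendByZero` (auxiliary, see the module docstring). [folklore] -/
theorem isNormalized_extendByZero (h : S₁.toLabelled.IsNormalized) :
    (extendByZero c₀ S₁).IsNormalized := fun k F => by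
  rw [extendByZero_of_all c₀ S₁ (fun i => i.elim0)]
  exact h (fun _ => ()) F

/-- `isHermitian_extendByZero` (auxiliary, see the module docstring). [folklore] -/
theorem isHermitian_extendByZero (h : S₁.toLabelled.IsHermitian) :
    (extendByZero c₀ S₁).IsHermitian := fun n k F hF => by
  by_cases hk : ∀ i, k i = c₀
  · rw [extendByZero_of_all c₀ S₁ hk, extendByZero_of_all c₀ S₁ ((all_comp_rev_iff k c₀).2 hk)]
    exact h n (fun _ => ()) F hF
  · rw [extendByZero_of_not_all c₀ S₁ hk,
      extendByZero_of_not_all c₀ S₁ (mt (all_comp_rev_iff k c₀).1 hk)]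
    simp

/-- `hasLinearGrowth_extendByZero` (auxiliary, see the module docstring). [folklore] -/
theorem hasLinearGrowth_extendByZero (h : S₁.toLabelled.HasLinearGrowth) :
    (extendByZero c₀ S₁).HasLinearGrowth := by
  intro T
  obtain ⟨s, α, β, hb⟩ := h Finset.univ
  refine ⟨s, max α 0, β, fun n k _ F hF => ?_⟩
  have hnn : 0 ≤ (n.factorial : ℝ) ^ β * schwartzNorm (n * s) F :=
    mul_nonneg (Real.rpow_nonneg (Nat.cast_nonneg _) _) (schwartzNorm_nonneg _ _)
  by_cases hk : ∀ i, k i = c₀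
  · rw [extendByZero_of_all c₀ S₁ hk]
    calc ‖S₁ n F‖ = ‖S₁.toLabelled n (fun _ => ()) F‖ := rfl
      _ ≤ α * (n.factorial : ℝ) ^ β * schwartzNorm (n * s) F :=
          hb n (fun _ => ()) (fun _ => Finset.mem_univ _) F hF
      _ ≤ max α 0 * (n.factorial : ℝ) ^ β * schwartzNorm (n * s) F := by
          rw [mul_assoc, mul_assoc]; exact mul_le_mul_of_nonneg_right (le_max_left _ _) hnn
  · rw [extendByZero_of_not_all c₀ S₁ hk]
    simp only [zero_apply, norm_zero]
    rw [mul_assoc]; exact mul_nonneg (le_max_right _ _) hnn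

/-- `isReflectionPositive_extendByZero` (auxiliary, see the module docstring). [folklore] -/
theorem isReflectionPositive_extendByZero (h : S₁.toLabelled.IsReflectionPositive) :
    (extendByZero c₀ S₁).IsReflectionPositive := by
  classical
  intro N deg lab F hF H hH
  let good : Fin N → Prop := fun j => ∀ i, lab j i = c₀
  let F' : (j : Fin N) → 𝓢((Fin (deg j) → (EuclideanSpace ℝ (Fin 4))), ℂ) := fun j => if good j then F j else 0
  let H' : (i j : Fin N) → 𝓢((Fin (deg i + deg j) → (EuclideanSpace ℝ (Fin 4))), ℂ) :=
    fun i j => if good i ∧ good j then H i j else 0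
  have hF' : ∀ j, IsTimeOrdered (F' j) := fun j => by
    by_cases hj : good j
    · simp only [F', if_pos hj]; exact hF j
    · simp only [F', if_neg hj]; exact isTimeOrdered_zero
  have hH' : ∀ i j, IsAppendTensorOf (H' i j) (osAdjoint (F' i)) (F' j) := fun i j => by
    by_cases hi : good i
    · by_cases hj : good j
      · simp only [H', F', if_pos hi, if_pos hj, if_pos (And.intro hi hj)]; exact hH i j
      · simp only [H', F', if_neg hj, if_neg (fun h : good i ∧ good j => hj h.2)]
        intro x; simp
    · simp only [H', F', if_neg hi, if_neg (fun h : good i ∧ good j => hi h.1), osAdjoint_zero]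
      intro x; simp
  have key := h N deg (fun j _ => ()) F' hF' H' hH'
  have hterm : ∀ i j, extendByZero c₀ S₁ (deg i + deg j) (Fin.append (lab i ∘ Fin.rev) (lab j)) (H i j) =
      S₁.toLabelled (deg i + deg j) (Fin.append ((fun _ => ()) ∘ Fin.rev) (fun _ => ())) (H' i j) := by
    intro i j
    by_cases hij : good i ∧ good j
    · rw [extendByZero_of_all c₀ S₁ ((all_append_iff _ _ c₀).2
        ⟨(all_comp_rev_iff _ c₀).2 hij.1, hij.2⟩)]
      simp only [H', if_pos hij, SchwingerFamily.toLabelled_apply]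
    · rw [extendByZero_of_not_all c₀ S₁ (fun hall => hij
        ⟨(all_comp_rev_iff _ c₀).1 ((all_append_iff _ _ c₀).1 hall).1, ((all_append_iff _ _ c₀).1 hall).2⟩)]
      simp only [H', if_neg hij, SchwingerFamily.toLabelled_apply, map_zero,
        zero_apply]
  simp only [hterm]
  exact key

/-- `isSymmetric_extendByZero` (auxiliary, see the module docstring). [folklore] -/
theorem isSymmetric_extendByZero (h : S₁.toLabelled.IsSymmetric) :
    (extendByZero c₀ S₁).IsSymmetric := fun n k π F hF => by
  by_cases hk : ∀ i, k i = c₀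
  · rw [extendByZero_of_all c₀ S₁ hk, extendByZero_of_all c₀ S₁ ((all_comp_perm_iff k π c₀).2 hk)]
    exact h n (fun _ => ()) π F hF
  · rw [extendByZero_of_not_all c₀ S₁ hk,
      extendByZero_of_not_all c₀ S₁ (mt (all_comp_perm_iff k π c₀).1 hk)]
    simp

/-- `hasClusterProperty_extendByZero` (auxiliary, see the module docstring). [folklore] -/
theorem hasClusterProperty_extendByZero (h : S₁.toLabelled.HasClusterProperty) :
    (extendByZero c₀ S₁).HasClusterProperty := by
  intro n m k k' F G hF hG a ha0 ha H hH
  by_cases hk : ∀ i, k i = c₀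
  · by_cases hk' : ∀ j, k' j = c₀
    · have hall : ∀ i, Fin.append (k ∘ Fin.rev) k' i = c₀ :=
        (all_append_iff _ _ c₀).2 ⟨(all_comp_rev_iff _ c₀).2 hk, hk'⟩
      simp only [extendByZero_of_all c₀ S₁ hall, extendByZero_of_all c₀ S₁ hk',
        extendByZero_of_all c₀ S₁ ((all_comp_rev_iff _ c₀).2 hk)]
      simpa using h n m (fun _ => ()) (fun _ => ()) F G hF hG a ha0 ha H hH
    · have hnall : ¬ ∀ i, Fin.append (k ∘ Fin.rev) k' i = c₀ :=
        fun hall => hk' ((all_append_iff _ _ c₀).1 hall).2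
      simp only [extendByZero_of_not_all c₀ S₁ hnall, extendByZero_of_not_all c₀ S₁ hk']
      simp
  · have hnall : ¬ ∀ i, Fin.append (k ∘ Fin.rev) k' i = c₀ :=
      fun hall => hk ((all_comp_rev_iff _ c₀).1 ((all_append_iff _ _ c₀).1 hall).1)
    simp only [extendByZero_of_not_all c₀ S₁ hnall,
      extendByZero_of_not_all c₀ S₁ (mt (all_comp_rev_iff k c₀).1 hk)]
    simp

/-- `hasMassGap_extendByZero` (auxiliary, see the module docstring). [folklore] -/
theorem hasMassGap_extendByZero {Δ : ℝ} (h : S₁.toLabelled.HasMassGap Δ) :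
    (extendByZero c₀ S₁).HasMassGap Δ := by
  intro n m k k' F G hF hG
  by_cases hk : ∀ i, k i = c₀
  · by_cases hk' : ∀ j, k' j = c₀
    · obtain ⟨C, hC⟩ := h n m (fun _ => ()) (fun _ => ()) F G hF hG
      refine ⟨C, fun t ht H hH => ?_⟩
      have hall : ∀ i, Fin.append (k ∘ Fin.rev) k' i = c₀ :=
        (all_append_iff _ _ c₀).2 ⟨(all_comp_rev_iff _ c₀).2 hk, hk'⟩
      simp only [extendByZero_of_all c₀ S₁ hall, extendByZero_of_all c₀ S₁ hk',
        extendByZero_of_all c₀ S₁ ((all_comp_rev_iff _ c₀).2 hk)]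
      simpa using hC t ht H hH
    · refine ⟨0, fun t ht H hH => ?_⟩
      have hnall : ¬ ∀ i, Fin.append (k ∘ Fin.rev) k' i = c₀ :=
        fun hall => hk' ((all_append_iff _ _ c₀).1 hall).2
      simp [extendByZero_of_not_all c₀ S₁ hnall, extendByZero_of_not_all c₀ S₁ hk']
  · refine ⟨0, fun t ht H hH => ?_⟩
    have hnall : ¬ ∀ i, Fin.append (k ∘ Fin.rev) k' i = c₀ :=
      fun hall => hk ((all_comp_rev_iff _ c₀).1 ((all_append_iff _ _ c₀).1 hall).1)
    simp [extendByZero_of_not_all c₀ S₁ hnall,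
      extendByZero_of_not_all c₀ S₁ (mt (all_comp_rev_iff k c₀).1 hk)]

/-- `osClauses_extendByZero` (auxiliary, see the module docstring). [folklore] -/
theorem osClauses_extendByZero (h : (S₁.toLabelled.IsNormalized ∧ S₁.toLabelled.IsHermitian ∧ S₁.toLabelled.HasLinearGrowth ∧ S₁.toLabelled.IsReflectionPositive ∧
      S₁.toLabelled.IsSymmetric ∧ S₁.toLabelled.HasClusterProperty ∧
      (∀ (n : ℕ) (k : Fin n → Unit) (a : (EuclideanSpace ℝ (Fin 4))) (F : 𝓢((Fin n → (EuclideanSpace ℝ (Fin 4))), ℂ)), IsOffDiagonal F →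
        S₁.toLabelled n k (translateMulti a F) = S₁.toLabelled n k F) ∧
      (∀ (n : ℕ) (k : Fin n → Unit) (R : (EuclideanSpace ℝ (Fin 4)) ≃ₗᵢ[ℝ] (EuclideanSpace ℝ (Fin 4))),
        LinearMap.det (R.toLinearEquiv : (EuclideanSpace ℝ (Fin 4)) →ₗ[ℝ] (EuclideanSpace ℝ (Fin 4))) = 1 →
        (∀ i : Fin 4, ∃ j : Fin 4, R (EuclideanSpace.single i 1) = EuclideanSpace.single j 1 ∨
          R (EuclideanSpace.single i 1) = -EuclideanSpace.single j 1) →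
        ∀ F : 𝓢((Fin n → (EuclideanSpace ℝ (Fin 4))), ℂ), IsOffDiagonal F → S₁.toLabelled n k (linActMulti R F) = S₁.toLabelled n k F))) :
    ((extendByZero c₀ S₁).IsNormalized ∧ (extendByZero c₀ S₁).IsHermitian ∧ (extendByZero c₀ S₁).HasLinearGrowth ∧ (extendByZero c₀ S₁).IsReflectionPositive ∧
      (extendByZero c₀ S₁).IsSymmetric ∧ (extendByZero c₀ S₁).HasClusterProperty ∧
      (∀ (n : ℕ) (k : Fin n → ι) (a : (EuclideanSpace ℝ (Fin 4))) (F : 𝓢((Fin n → (EuclideanSpace ℝ (Fin 4))), ℂ)), IsOffDiagonal F →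
        (extendByZero c₀ S₁) n k (translateMulti a F) = (extendByZero c₀ S₁) n k F) ∧
      (∀ (n : ℕ) (k : Fin n → ι) (R : (EuclideanSpace ℝ (Fin 4)) ≃ₗᵢ[ℝ] (EuclideanSpace ℝ (Fin 4))),
        LinearMap.det (R.toLinearEquiv : (EuclideanSpace ℝ (Fin 4)) →ₗ[ℝ] (EuclideanSpace ℝ (Fin 4))) = 1 →
        (∀ i : Fin 4, ∃ j : Fin 4, R (EuclideanSpace.single i 1) = EuclideanSpace.single j 1 ∨
          R (EuclideanSpace.single i 1) = -EuclideanSpace.single j 1) →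
        ∀ F : 𝓢((Fin n → (EuclideanSpace ℝ (Fin 4))), ℂ), IsOffDiagonal F → (extendByZero c₀ S₁) n k (linActMulti R F) = (extendByZero c₀ S₁) n k F)) := by
  obtain ⟨h0, h1, h2, h3, h4, h5, h6, h7⟩ := h
  refine ⟨isNormalized_extendByZero h0, isHermitian_extendByZero h1, hasLinearGrowth_extendByZero h2,
    isReflectionPositive_extendByZero h3, isSymmetric_extendByZero h4,
    hasClusterProperty_extendByZero h5, fun n k a F hF => ?_, fun n k R hR hperm F hF => ?_⟩
  · by_cases hk : ∀ i, k i = c₀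
    · rw [extendByZero_of_all c₀ S₁ hk]; exact h6 n (fun _ => ()) a F hF
    · rw [extendByZero_of_not_all c₀ S₁ hk]; rfl
  · by_cases hk : ∀ i, k i = c₀
    · rw [extendByZero_of_all c₀ S₁ hk]; exact h7 n (fun _ => ()) R hR hperm F hF
    · rw [extendByZero_of_not_all c₀ S₁ hk]; rfl

/-! ### Restriction of a labelled family to one constant label -/

/-- The one-field family of the species `c₀`. [folklore] -/
def restrictTo (c₀ : ι) (S : LabelledSchwingerFamily ι (EuclideanSpace ℝ (Fin 4))) : SchwingerFamily (EuclideanSpace ℝ (Fin 4)) :=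
  fun n => S n (fun _ => c₀)

/-- `restrictTo_toLabelled` (auxiliary, see the module docstring). [folklore] -/
@[simp] theorem restrictTo_toLabelled (c₀ : ι) (S : LabelledSchwingerFamily ι (EuclideanSpace ℝ (Fin 4))) (n : ℕ)
    (k : Fin n → Unit) : (restrictTo c₀ S).toLabelled n k = S n (fun _ => c₀) := rfl

/-- `osClauses_restrictTo` (auxiliary, see the module docstring). [folklore] -/
theorem osClauses_restrictTo (c₀ : ι) {S : LabelledSchwingerFamily ι (EuclideanSpace ℝ (Fin 4))} (h : (S.IsNormalized ∧ S.IsHermitian ∧ S.HasLinearGrowth ∧ S.IsReflectionPositive ∧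
      S.IsSymmetric ∧ S.HasClusterProperty ∧
      (∀ (n : ℕ) (k : Fin n → ι) (a : (EuclideanSpace ℝ (Fin 4))) (F : 𝓢((Fin n → (EuclideanSpace ℝ (Fin 4))), ℂ)), IsOffDiagonal F →
        S n k (translateMulti a F) = S n k F) ∧
      (∀ (n : ℕ) (k : Fin n → ι) (R : (EuclideanSpace ℝ (Fin 4)) ≃ₗᵢ[ℝ] (EuclideanSpace ℝ (Fin 4))),
        LinearMap.det (R.toLinearEquiv : (EuclideanSpace ℝ (Fin 4)) →ₗ[ℝ] (EuclideanSpace ℝ (Fin 4))) = 1 →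
        (∀ i : Fin 4, ∃ j : Fin 4, R (EuclideanSpace.single i 1) = EuclideanSpace.single j 1 ∨
          R (EuclideanSpace.single i 1) = -EuclideanSpace.single j 1) →
        ∀ F : 𝓢((Fin n → (EuclideanSpace ℝ (Fin 4))), ℂ), IsOffDiagonal F → S n k (linActMulti R F) = S n k F))) :
    ((restrictTo c₀ S).toLabelled.IsNormalized ∧ (restrictTo c₀ S).toLabelled.IsHermitian ∧ (restrictTo c₀ S).toLabelled.HasLinearGrowth ∧ (restrictTo c₀ S).toLabelled.IsReflectionPositive ∧
      (restrictTo c₀ S).toLabelled.IsSymmetric ∧ (restrictTo c₀ S).toLabelled.HasClusterProperty ∧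
      (∀ (n : ℕ) (k : Fin n → Unit) (a : (EuclideanSpace ℝ (Fin 4))) (F : 𝓢((Fin n → (EuclideanSpace ℝ (Fin 4))), ℂ)), IsOffDiagonal F →
        (restrictTo c₀ S).toLabelled n k (translateMulti a F) = (restrictTo c₀ S).toLabelled n k F) ∧
      (∀ (n : ℕ) (k : Fin n → Unit) (R : (EuclideanSpace ℝ (Fin 4)) ≃ₗᵢ[ℝ] (EuclideanSpace ℝ (Fin 4))),
        LinearMap.det (R.toLinearEquiv : (EuclideanSpace ℝ (Fin 4)) →ₗ[ℝ] (EuclideanSpace ℝ (Fin 4))) = 1 →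
        (∀ i : Fin 4, ∃ j : Fin 4, R (EuclideanSpace.single i 1) = EuclideanSpace.single j 1 ∨
          R (EuclideanSpace.single i 1) = -EuclideanSpace.single j 1) →
        ∀ F : 𝓢((Fin n → (EuclideanSpace ℝ (Fin 4))), ℂ), IsOffDiagonal F → (restrictTo c₀ S).toLabelled n k (linActMulti R F) = (restrictTo c₀ S).toLabelled n k F)) := by
  obtain ⟨h0, h1, h2, h3, h4, h5, h6, h7⟩ := h
  refine ⟨fun k F => h0 _ F, fun n k F hF => h1 n _ F hF, ?_, ?_, fun n k π F hF => h4 n _ π F hF,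
    ?_, fun n k a F hF => h6 n _ a F hF, fun n k R hR hperm F hF => h7 n _ R hR hperm F hF⟩
  · intro T
    obtain ⟨s, α, β, hb⟩ := h2 {c₀}
    exact ⟨s, α, β, fun n k _ F hF => hb n (fun _ => c₀) (fun _ => Finset.mem_singleton_self _) F hF⟩
  · intro N deg lab F hF H hH
    have key := h3 N deg (fun j _ => c₀) F hF H hH
    simp only [Function.comp_def, append_const] at key
    simpa [restrictTo, Function.comp_def, append_const] using key
  · intro n m k k' F G hF hG a ha0 ha H hH
    have key := h5 n m (fun _ => c₀) (fun _ => c₀) F G hF hG a ha0 ha H hH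
    simp only [Function.comp_def, append_const] at key
    simpa [restrictTo, Function.comp_def, append_const] using key

/-- `hasMassGap_restrictTo` (auxiliary, see the module docstring). [folklore] -/
theorem hasMassGap_restrictTo (c₀ : ι) {S : LabelledSchwingerFamily ι (EuclideanSpace ℝ (Fin 4))} {Δ : ℝ}
    (h : S.HasMassGap Δ) : (restrictTo c₀ S).toLabelled.HasMassGap Δ :=
  h.restrict fun _ : Unit => c₀


end ExtendRestrict

end Summit.QuantumFields.YangMills.Theorems.HypercubicLimit.Negative
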